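import Mathlib
import Summits.ValiantsHypothesis.ValiantsHypothesis.Theses.LiouvilleSarnak
import Summits.ValiantsHypothesis.ValiantsHypothesis.Theorems.LiouvilleSarnakCutRankFour

/-!
# Route LiouvilleSarnak — rung `LiouvilleCutRankFour` (stmt-ValiantsHypothesis-21039), line
# `window_certificate`: the registered stub `stub_windowRank`

The registered skeleton `Cruxes/LiouvilleCutRankFour/Lines/window_certificate.lean`
(planner `val-width-lines-2`, 2026-08-27) cuts the proof of the rung `LiouvilleCutRankFour`
(the `W = 4` instance of the crux `LiouvilleCutRank`, stmt-14775; PROVED in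
`Theorems/LiouvilleSarnakCutRankFour.lean`) into two stubs.  This file proves the second one,
`stub_windowRank`, with the skeleton-local definitions `windowCode` / `goodCodes` UNFOLDED
(so the statement below is definitionally the registered signature and the skeleton closes its
`sorry` by the one-line term `stub_windowRank n hn π s hs h` of this namespace):

* for `n ≥ 3`, a balanced cut `π : Fin n ⊕ Fin n ≃ Fin (2n)` and a window `s, …, s+4` of bit
  positions whose row/column word (bit `k` set iff position `s + k` is a row bit) is one of the
  eighteen GOOD codes `{3, 5, 6, 7, 10, 11, 12, 13, 14, 17, 18, 19, 20, 21, 24, 25, 26, 28}`, the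
  digital cut matrix `(λ(N_π(r, c) + 1))_{r,c}` has rank `≥ 4` over `ℂ`.

Proof: every good code has two or three row bits (`decide`), so the certificate
`cert_det_ne_zero` and the window embedding `four_le_rank_of_window` of
`Theorems/LiouvilleSarnakCutRankFour.lean` apply verbatim (the two words `RCCRC = 9`,
`CRRCR = 22` that the line excludes are simply not needed here; the certificate covers them too).

Honest framing: bookkeeping for a registered line of an already PROVED finite rung (`W = 4`);
the crux `LiouvilleCutRank` (every `W`), `DigitalBilinearLiouville` and `AlgebraicSarnak` stay
open, and nothing here bears on VP versus VNP.  No definitions.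
-/

-- the problem directory `ValiantsHypothesis/ValiantsHypothesis` repeats the summit name (tree layout)
set_option linter.dupNamespace false

namespace Summit.ValiantsHypothesis.ValiantsHypothesis.Theorems.LiouvilleSarnakCutRankFour.WindowCertificate

open ArithmeticFunction

/-- Each of the eighteen good window codes of the line `window_certificate` is `< 32` and has
exactly two or three row bits among its five. [folklore] -/
theorem count_testBit_of_mem_goodCodes :
    ∀ m ∈ ({3, 5, 6, 7, 10, 11, 12, 13, 14, 17, 18, 19, 20, 21, 24, 25, 26, 28} : Finset ℕ),
      m < 32 ∧ (Nat.count (fun k => Nat.testBit m k = true) 5 = 2 ∨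
        Nat.count (fun k => Nat.testBit m k = true) 5 = 3) := by
  decide

/-- **Registered stub `stub_windowRank` of the line `window_certificate`** (with `windowCode` and
`goodCodes` unfolded): if the row/column word of the window `s, …, s+4` of a balanced cut `π`
(`n ≥ 3`) is a good code, then the digital Liouville cut matrix `(λ(N_π(r,c)+1))_{r,c}` has rank
`≥ 4` over `ℂ` — window embedding (bits below the window `:= 1`, above `:= 0`,
`N + 1 = 2^s (K + 1)`, `λ(2^s x) = (-1)^s λ(x)`) onto one of the nonsingular `4 × 4` certificate
matrices on `λ|[1,32]`. [folklore] -/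
theorem stub_windowRank :
    ∀ n : ℕ, 3 ≤ n → ∀ π : Fin n ⊕ Fin n ≃ Fin (2 * n), ∀ (s : ℕ) (hs : s + 5 ≤ 2 * n),
      (Nat.ofBits fun k : Fin 5 => (π.symm ⟨s + k, by omega⟩).isLeft) ∈
        ({3, 5, 6, 7, 10, 11, 12, 13, 14, 17, 18, 19, 20, 21, 24, 25, 26, 28} : Finset ℕ) →
      4 ≤ (Matrix.of fun r c : Fin n → Bool =>
        (((ArithmeticFunction.liouville
          (Nat.ofBits (fun j : Fin (2 * n) => Sum.elim r c (π.symm j)) + 1) : ℤ) : ℂ))).rank := by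
  intro n _hn π s hs hgood
  -- the window code records the row/column pattern of the window
  have hmk : ∀ j : Fin (2 * n), s ≤ (j : ℕ) → (j : ℕ) < s + 5 →
      Nat.testBit (Nat.ofBits (fun k : Fin 5 => (π.symm ⟨s + k, by omega⟩).isLeft)) (j - s) =
        (π.symm j).isLeft := by
    intro j h1 h2
    have e : (⟨s + ((j : ℕ) - s), by omega⟩ : Fin (2 * n)) = j :=
      Fin.ext (show s + ((j : ℕ) - s) = (j : ℕ) by omega)
    rw [Nat.testBit_ofBits_lt _ _ (show (j : ℕ) - s < 5 by omega)]
    dsimp only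
    rw [e]
  obtain ⟨_, hcount⟩ := count_testBit_of_mem_goodCodes _ hgood
  exact four_le_rank_of_window n π s hs _ _ _ hmk
    (cert_det_ne_zero _ (Nat.ofBits_lt_two_pow _) hcount)

end Summit.ValiantsHypothesis.ValiantsHypothesis.Theorems.LiouvilleSarnakCutRankFour.WindowCertificate
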